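import Summits.AnomalousDissipation.AnomalousDissipation.Theses.TwoAndHalfD
import Summits.AnomalousDissipation.AnomalousDissipation.Theorems.TwoAndHalfDScalarAnomalySteadySourceFormalColdStartVarianceToolkit
import Literature.Analysis.FluidPDE.PassiveScalarClassicalEnergy
import Literature.Analysis.FluidPDE.PassiveScalarEnergySlice
import Literature.Analysis.FluidPDE.TimeAverageMeasureBasic
import Literature.Analysis.FluidPDE.LongTimeAverageNonneg
import Literature.Analysis.FluidPDE.CheskidovAssemblyTools

/-!
# S4 `stub_dissipationFromPower`: mean dissipation = mean input power (sourced `L²` balance)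

Stub S4 of the line `budgeted-mixer-template` for the crux
`Summit.AnomalousDissipation.AnomalousDissipation.Theses.TwoAndHalfD.ScalarAnomalySteadySourceFormal`
(stmt-AnomalousDissipation-0448); the statement is registered verbatim in the line's checked
skeleton (`Cruxes/ScalarAnomalySteadySourceFormal/Lines/budgeted-mixer-template.lean`) and is
consumed by the kernel-checked composition `ScalarAnomalySteadySourceFormal_of` there.

CONTENT. For a classical solution `θ` of `∂ₜθ + u·∇θ = κΔθ + h` on `T² × [0, ∞)` (`κ ≥ 0`,
steady source `h`) whose `L²` norm is bounded (`‖θ(t)‖² ≤ B` for `t ≥ 0`) and whose input power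
is eventually floored (`∫ h θ(t) ≥ e` for `t ≥ t₀`):
`e ≤ limsup_{T → ∞} T⁻¹ ∫₀ᵀ κ‖∇θ(t)‖² dt` (spectral gradient norm `Torus.eScalarGradNormSq`,
`ENNReal.toReal`, Cesàro means `timeMean`, `longTimeAvgSup`).

PROOF ("power = dissipation in the mean", Doering–Foias 2002 §2; DEIJ 2022 (1.2)–(1.3)). The
sourced `L²` balance `d/dt ‖θ‖² = -2κ‖∇θ‖² + 2∫ θ h` within `[0, ∞)` (landed toolkit
`ColdStartVariance.forced_hasDerivWithinAt_scalarL2Sq`) is integrated on `[0, T]`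
(`integral_scalarGradNormSq_eq`: both terms are continuous in time, fundamental theorem of
calculus): `κ∫₀ᵀ‖∇θ‖² = ∫₀ᵀ (θ, h) + (‖θ(0)‖² - ‖θ(T)‖²)/2`. With `T₀ = max t₀ 0` this is
`≥ eT - K` for `T ≥ T₀` (`K = eT₀ - ∫₀^{T₀}(θ, h) + B/2`) and `≤ MT + B/2`
(`(θ, h) ≤ √B‖h‖ =: M` by Cauchy–Schwarz), so the Cesàro means are eventually bounded above and
eventually `≥ e - δ` for every `δ > 0`, whence `limsup ≥ e`
(`le_longTimeAvgSup_of_linear_bounds`, Mathlib `Filter.le_limsup_of_frequently_le`). On smooth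
slices the spectral and the classical gradient norms agree (`scalarGradNormSq_eq_toReal_holds`);
values of `θ` at `t < 0` never enter. Supports stmt-AnomalousDissipation-0448. [folklore]
-/

-- the summit path `AnomalousDissipation/AnomalousDissipation` duplicates a namespace component
set_option linter.dupNamespace false

noncomputable section

namespace Summit.AnomalousDissipation.AnomalousDissipation.Theorems.ScalarAnomalySteadySourceFormal.DissipationFromPower

open MeasureTheory Filter Topology
open scoped ENNReal NNReal
open Literature.Analysis.FunctionSpaces Literature.Analysis.FluidPDE
open Summit.AnomalousDissipation.AnomalousDissipation.Theorems.ScalarAnomalySteadySourceFormal.ColdStartVariance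

/-! ## Cesàro means: a linear lower bound on the integrals forces `limsup ≥ e` -/

/-- If the integrals `∫₀ᵀ g` are eventually squeezed between `eT - K` and `MT + K'`, then the
Cesàro means `T⁻¹∫₀ᵀ g` are eventually bounded above and eventually `≥ e - δ` for every `δ > 0`,
so `limsup_T T⁻¹∫₀ᵀ g ≥ e` (an honest `limsup`: Mathlib `Filter.le_limsup_of_frequently_le`).
[folklore] -/
theorem le_longTimeAvgSup_of_linear_bounds {g : ℝ → ℝ} {e K K' M T₀ : ℝ}
    (hlow : ∀ T, T₀ ≤ T → e * T - K ≤ ∫ t in (0 : ℝ)..T, g t)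
    (hup : ∀ T, T₀ ≤ T → ∫ t in (0 : ℝ)..T, g t ≤ M * T + K') :
    e ≤ longTimeAvgSup g := by
  have hev : ∀ᶠ T in atTop, timeMean g T ≤ M + |K'| := by
    filter_upwards [eventually_ge_atTop T₀, eventually_ge_atTop (1 : ℝ)] with T hT hT1
    have hT0 : 0 < T := one_pos.trans_le hT1
    have hinv : T⁻¹ * T = 1 := inv_mul_cancel₀ hT0.ne'
    have hi0 : 0 ≤ T⁻¹ := inv_nonneg.2 hT0.le
    have hi1 : T⁻¹ ≤ 1 := inv_le_one_of_one_le₀ hT1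
    have h1 : T⁻¹ * (∫ t in (0 : ℝ)..T, g t) ≤ T⁻¹ * (M * T + K') :=
      mul_le_mul_of_nonneg_left (hup T hT) hi0
    have h2 : T⁻¹ * (M * T + K') = M + K' * T⁻¹ := by linear_combination M * hinv
    have h3 : K' * T⁻¹ ≤ |K'| :=
      calc K' * T⁻¹ ≤ |K'| * T⁻¹ := mul_le_mul_of_nonneg_right (le_abs_self K') hi0
        _ ≤ |K'| * 1 := mul_le_mul_of_nonneg_left hi1 (abs_nonneg K')
        _ = |K'| := mul_one _
    unfold timeMean
    linarith
  have hbdd : IsBoundedUnder (· ≤ ·) atTop (timeMean g) := ⟨M + |K'|, hev⟩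
  unfold longTimeAvgSup
  refine le_of_forall_sub_le fun δ hδ =>
    le_limsup_of_frequently_le (Eventually.frequently ?_) hbdd
  have hKT : Tendsto (fun T : ℝ => |K| * T⁻¹) atTop (𝓝 0) := by
    simpa using tendsto_inv_atTop_zero.const_mul |K|
  filter_upwards [eventually_ge_atTop T₀, eventually_gt_atTop (0 : ℝ),
    hKT.eventually (gt_mem_nhds hδ)] with T hT hT0 hKδ
  have hKδ' : |K| * T⁻¹ < δ := hKδ
  have hinv : T⁻¹ * T = 1 := inv_mul_cancel₀ hT0.ne'
  have hi0 : 0 ≤ T⁻¹ := inv_nonneg.2 hT0.le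
  have h1 : T⁻¹ * (e * T - K) ≤ T⁻¹ * ∫ t in (0 : ℝ)..T, g t :=
    mul_le_mul_of_nonneg_left (hlow T hT) hi0
  have h2 : T⁻¹ * (e * T - K) = e - K * T⁻¹ := by linear_combination e * hinv
  have h3 : K * T⁻¹ ≤ |K| * T⁻¹ := mul_le_mul_of_nonneg_right (le_abs_self K) hi0
  unfold timeMean
  linarith

/-! ## The integrated sourced `L²` balance on `[0, T]` -/

section Balance

variable {d : Type*} [Fintype d] [DecidableEq d]

/-- A function continuous on `[0, ∞)` is interval integrable on every `[a, b]` with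
`0 ≤ a ≤ b`. [folklore] -/
theorem intervalIntegrable_of_continuousOn_Ici {f : ℝ → ℝ} (hf : ContinuousOn f (Set.Ici 0))
    {a b : ℝ} (ha : 0 ≤ a) (hab : a ≤ b) : IntervalIntegrable f volume a b := by
  refine (hf.mono ?_).intervalIntegrable
  rw [Set.uIcc_of_le hab]
  exact fun t ht => ha.trans ht.1

variable {κ : ℝ} {u : ℝ → UnitAddTorus d → EuclideanSpace ℝ d} {s θ : ℝ → UnitAddTorus d → ℝ}

/-- The input power `t ↦ ∫ θ(t) s(t)` of a classical forced solution on `[0, ∞)` is continuous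
in time (the integrand is jointly smooth). [folklore] -/
theorem continuousOn_integral_mul_source
    (h : Torus.IsClassicalScalarTransportForcedOn (Set.Ici 0) κ u s θ) :
    ContinuousOn (fun t => ∫ x, θ t x * s t x) (Set.Ici 0) :=
  (h.smooth_scalar.mul h.smooth_source).continuousOn_integral (convex_Ici 0)

/-- The scalar enstrophy `t ↦ ‖∇θ(t)‖²_{L²}` of a classical forced solution on `[0, ∞)` is
continuous in time. [folklore] -/
theorem continuousOn_scalarGradNormSq
    (h : Torus.IsClassicalScalarTransportForcedOn (Set.Ici 0) κ u s θ) :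
    ContinuousOn (fun t => Torus.scalarGradNormSq (θ t)) (Set.Ici 0) :=
  h.smooth_scalar.continuousOn_scalarGradNormSq (convex_Ici 0) (uniqueDiffOn_Ici 0)

/-- **The integrated sourced `L²` balance** (DEIJ 2022, (1.2)–(1.3) with a source;
Doering–Foias 2002, §2): for a classical solution of `∂ₜθ + u·∇θ = κΔθ + s` on `[0, ∞) × T^d`
and `T ≥ 0`, `‖θ(T)‖² - ‖θ(0)‖² = -2κ∫₀ᵀ‖∇θ‖² + 2∫₀ᵀ∫ θ s` (the balance
`forced_hasDerivWithinAt_scalarL2Sq` within `[0, ∞)` has a continuous right-hand side; apply the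
fundamental theorem of calculus on `[0, T]`). [folklore] -/
theorem scalarL2Sq_sub_eq_integral
    (h : Torus.IsClassicalScalarTransportForcedOn (Set.Ici 0) κ u s θ) {T : ℝ} (hT : 0 ≤ T) :
    Torus.scalarL2Sq (θ T) - Torus.scalarL2Sq (θ 0) =
      -(2 * κ) * (∫ t in (0 : ℝ)..T, Torus.scalarGradNormSq (θ t)) +
        2 * ∫ t in (0 : ℝ)..T, ∫ x, θ t x * s t x := by
  have hder : ∀ t ∈ Set.Ici (0 : ℝ), HasDerivWithinAt (fun τ => Torus.scalarL2Sq (θ τ))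
      (-(2 * κ) * Torus.scalarGradNormSq (θ t) + 2 * ∫ x, θ t x * s t x) (Set.Ici 0) t :=
    fun t ht => forced_hasDerivWithinAt_scalarL2Sq h (convex_Ici 0) ht
  have hGi := intervalIntegrable_of_continuousOn_Ici (continuousOn_scalarGradNormSq h) le_rfl hT
  have hPi := intervalIntegrable_of_continuousOn_Ici (continuousOn_integral_mul_source h) le_rfl hT
  have hFTC : ∫ t in (0 : ℝ)..T,
      (-(2 * κ) * Torus.scalarGradNormSq (θ t) + 2 * ∫ x, θ t x * s t x) =
        Torus.scalarL2Sq (θ T) - Torus.scalarL2Sq (θ 0) :=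
    intervalIntegral.integral_eq_sub_of_hasDerivAt_of_le hT
      (fun t ht => (hder t (Set.Icc_subset_Ici_self ht)).continuousWithinAt.mono
        Set.Icc_subset_Ici_self)
      (fun t ht => (hder t (le_of_lt ht.1)).hasDerivAt (Ici_mem_nhds ht.1))
      ((hGi.const_mul _).add (hPi.const_mul _))
  rw [intervalIntegral.integral_add (hGi.const_mul _) (hPi.const_mul _),
    intervalIntegral.integral_const_mul, intervalIntegral.integral_const_mul] at hFTC
  exact hFTC.symm

end Balance

/-! ## The stub: the dissipation floor from an eventual input-power floor -/

/-- **S4 `stub_dissipationFromPower` (line `budgeted-mixer-template`, crux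
`TwoAndHalfD.ScalarAnomalySteadySourceFormal`).** For a classical solution `θ` of
`∂ₜθ + u·∇θ = κΔθ + h` on `T² × [0, ∞)` (`κ ≥ 0`, steady source `h`) with `‖θ(t)‖²_{L²} ≤ B`
for `t ≥ 0` and `∫ h θ(t) ≥ e` for `t ≥ t₀`: `e ≤ limsup_T T⁻¹∫₀ᵀ κ‖∇θ(t)‖² dt` (spectral
`Torus.eScalarGradNormSq`, `toReal`). Proof: the integrated sourced balance
(`scalarL2Sq_sub_eq_integral`) gives `κ∫₀ᵀ‖∇θ‖² = ∫₀ᵀ (θ, h) + (‖θ(0)‖² - ‖θ(T)‖²)/2`, which is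
`≥ eT - K` for `T ≥ max t₀ 0` and `≤ √B‖h‖T + B/2` (Cauchy–Schwarz,
`integral_mul_le_sqrt_mul_sqrt`); conclude with `le_longTimeAvgSup_of_linear_bounds`, after
identifying the spectral and classical gradient norms on the smooth slices `θ(t)`, `t ≥ 0`
(`scalarGradNormSq_eq_toReal_holds`). "Power = dissipation in the mean" (Doering–Foias 2002,
§2; DEIJ 2022, (1.2)–(1.3)). [folklore] -/
theorem stub_dissipationFromPower :
    ∀ (κ B e t₀ : ℝ) (u : ℝ → UnitAddTorus (Fin 2) → EuclideanSpace ℝ (Fin 2))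
      (h : UnitAddTorus (Fin 2) → ℝ) (θ : ℝ → UnitAddTorus (Fin 2) → ℝ),
      0 ≤ κ →
      Torus.IsClassicalScalarTransportForcedOn (Set.Ici 0) κ u (fun _ => h) θ →
      (∀ t, 0 ≤ t → Torus.scalarL2Sq (θ t) ≤ B) →
      (∀ t, t₀ ≤ t → e ≤ ∫ x, h x * θ t x) →
      e ≤ longTimeAvgSup (fun t => κ * (Torus.eScalarGradNormSq (θ t)).toReal) := by
  intro κ B e t₀ u h θ _ hsol hB hP
  have hh : Torus.IsSmooth h := hsol.smooth_source.isSmooth_slice Set.self_mem_Ici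
  have hslice : ∀ t, 0 ≤ t → Torus.IsSmooth (θ t) := fun t ht =>
    hsol.smooth_scalar.isSmooth_slice (Set.mem_Ici.2 ht)
  have hPc : ContinuousOn (fun t => ∫ x, θ t x * h x) (Set.Ici 0) :=
    continuousOn_integral_mul_source hsol
  have hii : ∀ {a b : ℝ}, 0 ≤ a → a ≤ b →
      IntervalIntegrable (fun t => ∫ x, θ t x * h x) volume a b :=
    fun ha hab => intervalIntegrable_of_continuousOn_Ici hPc ha hab
  -- pointwise bounds on the input power `∫ θ(t) h`
  obtain ⟨M, hPM⟩ : ∃ M : ℝ, ∀ t, 0 ≤ t → ∫ x, θ t x * h x ≤ M := by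
    refine ⟨√B * √(Torus.scalarL2Sq h), fun t ht => ?_⟩
    have h1 : √(∫ x, θ t x ^ 2) ≤ √B := Real.sqrt_le_sqrt (hB t ht)
    calc ∫ x, θ t x * h x ≤ √(∫ x, θ t x ^ 2) * √(∫ x, h x ^ 2) :=
          integral_mul_le_sqrt_mul_sqrt ((hslice t ht).memLp 2) (hh.memLp 2)
      _ ≤ √B * √(Torus.scalarL2Sq h) := mul_le_mul_of_nonneg_right h1 (Real.sqrt_nonneg _)
  have hPe : ∀ t, t₀ ≤ t → e ≤ ∫ x, θ t x * h x := fun t ht => by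
    have h1 : ∫ x, θ t x * h x = ∫ x, h x * θ t x :=
      integral_congr_ae (Eventually.of_forall fun x => mul_comm _ _)
    rw [h1]
    exact hP t ht
  -- bounds on the integrated input power
  set T₀ : ℝ := max t₀ 0 with hT₀_def
  have hT₀0 : 0 ≤ T₀ := le_max_right _ _
  have hT₀t : t₀ ≤ T₀ := le_max_left _ _
  have hIup : ∀ T, 0 ≤ T → ∫ t in (0 : ℝ)..T, (∫ x, θ t x * h x) ≤ M * T := by
    intro T hT
    calc ∫ t in (0 : ℝ)..T, (∫ x, θ t x * h x) ≤ ∫ _ in (0 : ℝ)..T, M :=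
          intervalIntegral.integral_mono_on hT (hii le_rfl hT) intervalIntegrable_const
            fun t ht => hPM t ht.1
      _ = M * T := by rw [intervalIntegral.integral_const, smul_eq_mul]; ring
  have hIlow : ∀ T, T₀ ≤ T → e * (T - T₀) + ∫ t in (0 : ℝ)..T₀, (∫ x, θ t x * h x) ≤
      ∫ t in (0 : ℝ)..T, (∫ x, θ t x * h x) := by
    intro T hT
    have h1 := intervalIntegral.integral_mono_on hT intervalIntegrable_const (hii hT₀0 hT)
      fun t ht => hPe t (hT₀t.trans ht.1)
    rw [intervalIntegral.integral_const, smul_eq_mul] at h1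
    have h2 := intervalIntegral.integral_add_adjacent_intervals (hii le_rfl hT₀0) (hii hT₀0 hT)
    linarith
  -- the integrated balance, and the spectral form of the dissipation observable on `(0, ∞)`
  have hbal : ∀ T, 0 ≤ T → κ * ∫ t in (0 : ℝ)..T, Torus.scalarGradNormSq (θ t) =
      (∫ t in (0 : ℝ)..T, ∫ x, θ t x * h x) +
        (Torus.scalarL2Sq (θ 0) - Torus.scalarL2Sq (θ T)) / 2 := by
    intro T hT
    have h1 : Torus.scalarL2Sq (θ T) - Torus.scalarL2Sq (θ 0) =
        -(2 * κ) * (∫ t in (0 : ℝ)..T, Torus.scalarGradNormSq (θ t)) +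
          2 * ∫ t in (0 : ℝ)..T, ∫ x, θ t x * h x := scalarL2Sq_sub_eq_integral hsol hT
    linarith
  have hgI : ∀ T, 0 ≤ T → ∫ t in (0 : ℝ)..T, κ * (Torus.eScalarGradNormSq (θ t)).toReal =
      κ * ∫ t in (0 : ℝ)..T, Torus.scalarGradNormSq (θ t) := by
    intro T hT
    rw [← intervalIntegral.integral_const_mul]
    refine intervalIntegral.integral_congr fun t ht => ?_
    rw [Set.uIcc_of_le hT] at ht
    rw [Torus.scalarGradNormSq_eq_toReal_holds (hslice t ht.1)]
  -- assemble
  have hL0 : 0 ≤ Torus.scalarL2Sq (θ 0) := Torus.scalarL2Sq_nonneg _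
  have hL0B : Torus.scalarL2Sq (θ 0) ≤ B := hB 0 le_rfl
  refine le_longTimeAvgSup_of_linear_bounds (T₀ := T₀)
    (K := e * T₀ - (∫ t in (0 : ℝ)..T₀, ∫ x, θ t x * h x) + B / 2) (K' := B / 2) (M := M)
    (fun T hT => ?_) (fun T hT => ?_)
  · have hT0 : 0 ≤ T := hT₀0.trans hT
    rw [hgI T hT0, hbal T hT0]
    have h1 := hIlow T hT
    have h2 : Torus.scalarL2Sq (θ T) ≤ B := hB T hT0
    linarith
  · have hT0 : 0 ≤ T := hT₀0.trans hT
    rw [hgI T hT0, hbal T hT0]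
    have h1 := hIup T hT0
    have h2 : 0 ≤ Torus.scalarL2Sq (θ T) := Torus.scalarL2Sq_nonneg _
    linarith

end Summit.AnomalousDissipation.AnomalousDissipation.Theorems.ScalarAnomalySteadySourceFormal.DissipationFromPower

end
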